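import Summits.AtomisticToContinuum.Crystallization.Theorems.ExcessDecayLiouvilleLatticeCoordinates
import Summits.AtomisticToContinuum.Crystallization.Theorems.ExcessDecayLiouvilleVerticalDifferences

/-!
# Route `ExcessDecayLiouville`: the parametrisation of the sites by `Fin 2 × ℤ³`

Bookkeeping for (LR)/(IR)/(BB) of the energy route for item `ExcessDecay` (stmt-AtomisticToContinuum-9334; evidence
v4): the lattice coordinates are unique (`latticeCoords_eq`), a site determines its sublattice and lattice vector
(`site_repr_unique`), and therefore

`siteParam : Fin 2 × ℤ × ℤ × ℤ ≃ Sites₀ t A`,  `(m, i, j, k) ↦ t m + A (i u₁ + j u₂ + k w₃)`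

is a bijection (`exists_siteParam`, stated as an existence of an `Equiv` with its defining formula, so that no new
definition is introduced).  With it, `tsum`s over the sites can be re-indexed over `Fin 2 × ℤ³` (`Equiv.tsum_eq`) and
the coordinate shifts become the lattice translations (`latticeVec_succ`).
All `[folklore]`; helper lemmas, nothing here closes an item.
-/

noncomputable section

namespace Summit.AtomisticToContinuum.Crystallization.Theorems.ExcessDecayLiouville

open scoped BigOperators
open Literature.MathematicalPhysics.StatisticalMechanics
open Summit.AtomisticToContinuum.Crystallization.Theorems.PhononStabilityNegative

section

variable {t : Fin 2 → (EuclideanSpace ℝ (Fin 3))} {A : (EuclideanSpace ℝ (Fin 3)) →L[ℝ] (EuclideanSpace ℝ (Fin 3))}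

/-- **Uniqueness of lattice coordinates**: `z(i,j,k) = z(i′,j′,k′)` forces `(i,j,k) = (i′,j′,k′)`. [folklore] -/
theorem latticeCoords_eq {i j k i' j' k' : ℤ}
    (h : ((i : ℝ) • triangularVec₁ 1 + (j : ℝ) • triangularVec₂ 1 +
        (k : ℝ) • layerNormal (2 * Real.sqrt (2 / 3)) : (EuclideanSpace ℝ (Fin 3))) =
      (i' : ℝ) • triangularVec₁ 1 + (j' : ℝ) • triangularVec₂ 1 + (k' : ℝ) • layerNormal (2 * Real.sqrt (2 / 3))) :
    i = i' ∧ j = j' ∧ k = k' := by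
  obtain ⟨h0, h1, h2⟩ := hcpLiouvilleLam_apply i j k
  obtain ⟨h0', h1', h2'⟩ := hcpLiouvilleLam_apply i' j' k'
  have e0 := congrArg (fun z : EuclideanSpace ℝ (Fin 3) => z 0) h
  have e1 := congrArg (fun z : EuclideanSpace ℝ (Fin 3) => z 1) h
  have e2 := congrArg (fun z : EuclideanSpace ℝ (Fin 3) => z 2) h
  simp only at e0 e1 e2
  rw [h0, h0'] at e0
  rw [h1, h1'] at e1
  rw [h2, h2'] at e2
  have hs3 : (0 : ℝ) < √3 := Real.sqrt_pos.2 (by norm_num)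
  have hs23 : (0 : ℝ) < Real.sqrt (2 / 3) := Real.sqrt_pos.2 (by norm_num)
  have hj : (j : ℝ) = j' := by
    have := mul_right_cancel₀ (ne_of_gt (by positivity : (0 : ℝ) < √3 / 2)) e1
    exact this
  have hk : (k : ℝ) = k' := by
    have := mul_right_cancel₀ (ne_of_gt (by positivity : (0 : ℝ) < 2 * Real.sqrt (2 / 3))) e2
    exact this
  have hi : (i : ℝ) = i' := by rw [hj] at e0; linarith
  exact ⟨by exact_mod_cast hi, by exact_mod_cast hj, by exact_mod_cast hk⟩

/-- **A site determines its sublattice and its lattice vector.** [folklore] -/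
theorem site_repr_unique (hA : Adm₀ A) (hI : Inner₀ t A) {m m' : Fin 2} {z z' : EuclideanSpace ℝ (Fin 3)}
    (hz : z ∈ Λ₀) (hz' : z' ∈ Λ₀) (h : t m + A z = t m' + A z') : m = m' ∧ z = z' := by
  have hm : m = m' := by
    fin_cases m <;> fin_cases m'
    · rfl
    · exact absurd h (sublattice_ne hA hI hz hz')
    · exact absurd h.symm (sublattice_ne hA hI hz' hz)
    · rfl
  subst hm
  refine ⟨rfl, ?_⟩
  have : A z = A z' := add_left_cancel h
  exact injective_of_adm₀ hA this

/-- **The parametrisation of the sites by `Fin 2 × ℤ³`** (see the module docstring). [folklore] -/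
theorem exists_siteParam (hA : Adm₀ A) (hI : Inner₀ t A) :
    ∃ e : Fin 2 × ℤ × ℤ × ℤ ≃ Sites₀ t A, ∀ m : Fin 2, ∀ i j k : ℤ,
      ((e (m, i, j, k) : Sites₀ t A) : EuclideanSpace ℝ (Fin 3)) =
        t m + A ((i : ℝ) • triangularVec₁ 1 + (j : ℝ) • triangularVec₂ 1 + (k : ℝ) • layerNormal (2 * Real.sqrt (2 / 3))) := by
  classical
  let f : Fin 2 × ℤ × ℤ × ℤ → Sites₀ t A := fun x =>
    ⟨t x.1 + A ((x.2.1 : ℝ) • triangularVec₁ 1 + (x.2.2.1 : ℝ) • triangularVec₂ 1 +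
        (x.2.2.2 : ℝ) • layerNormal (2 * Real.sqrt (2 / 3))),
      ⟨x.1, _, latticeVec_mem_Λ₀ x.2.1 x.2.2.1 x.2.2.2, rfl⟩⟩
  have hinj : Function.Injective f := by
    rintro ⟨m, i, j, k⟩ ⟨m', i', j', k'⟩ hff
    have hv : t m + A ((i : ℝ) • triangularVec₁ 1 + (j : ℝ) • triangularVec₂ 1 +
        (k : ℝ) • layerNormal (2 * Real.sqrt (2 / 3))) =
        t m' + A ((i' : ℝ) • triangularVec₁ 1 + (j' : ℝ) • triangularVec₂ 1 +
        (k' : ℝ) • layerNormal (2 * Real.sqrt (2 / 3))) := congrArg Subtype.val hff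
    obtain ⟨hm, hz⟩ := site_repr_unique hA hI (latticeVec_mem_Λ₀ i j k) (latticeVec_mem_Λ₀ i' j' k') hv
    obtain ⟨hi, hj, hk⟩ := latticeCoords_eq hz
    subst hm; subst hi; subst hj; subst hk
    rfl
  have hsurj : Function.Surjective f := by
    rintro ⟨p, m, z, ⟨i, j, k, rfl⟩, rfl⟩
    exact ⟨(m, i, j, k), rfl⟩
  exact ⟨Equiv.ofBijective f ⟨hinj, hsurj⟩, fun m i j k => rfl⟩

/-- Coordinate shifts of the parametrisation are the lattice translations by `A u₁`, `A u₂`, `A w₃`. [folklore] -/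
theorem siteParam_succ (e : Fin 2 × ℤ × ℤ × ℤ ≃ Sites₀ t A)
    (he : ∀ m : Fin 2, ∀ i j k : ℤ, ((e (m, i, j, k) : Sites₀ t A) : EuclideanSpace ℝ (Fin 3)) =
      t m + A ((i : ℝ) • triangularVec₁ 1 + (j : ℝ) • triangularVec₂ 1 + (k : ℝ) • layerNormal (2 * Real.sqrt (2 / 3))))
    (m : Fin 2) (i j k : ℤ) :
    ((e (m, i + 1, j, k) : Sites₀ t A) : EuclideanSpace ℝ (Fin 3)) = (e (m, i, j, k) : EuclideanSpace ℝ (Fin 3)) + A (triangularVec₁ 1) ∧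
    ((e (m, i, j + 1, k) : Sites₀ t A) : EuclideanSpace ℝ (Fin 3)) = (e (m, i, j, k) : EuclideanSpace ℝ (Fin 3)) + A (triangularVec₂ 1) ∧
    ((e (m, i, j, k + 1) : Sites₀ t A) : EuclideanSpace ℝ (Fin 3)) =
      (e (m, i, j, k) : EuclideanSpace ℝ (Fin 3)) + A (layerNormal (2 * Real.sqrt (2 / 3))) := by
  obtain ⟨h1, h2, h3⟩ := latticeVec_succ i j k
  refine ⟨?_, ?_, ?_⟩
  · rw [he, he, h1, map_add]; abel
  · rw [he, he, h2, map_add]; abel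
  · rw [he, he, h3, map_add]; abel

/-- Distance from the base site in terms of the coordinates: `dist (e(m,i,j,k)) (e(m,0,0,0)) = ‖A z(i,j,k)‖`, whence
`|i|, |j| ≤ (400/189)·dist` and `|k| ≤ (200/189)·dist`. [folklore] -/
theorem abs_coord_le_dist_siteParam (hA : Adm₀ A) (e : Fin 2 × ℤ × ℤ × ℤ ≃ Sites₀ t A)
    (he : ∀ m : Fin 2, ∀ i j k : ℤ, ((e (m, i, j, k) : Sites₀ t A) : EuclideanSpace ℝ (Fin 3)) =
      t m + A ((i : ℝ) • triangularVec₁ 1 + (j : ℝ) • triangularVec₂ 1 + (k : ℝ) • layerNormal (2 * Real.sqrt (2 / 3))))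
    (m : Fin 2) (i j k : ℤ) :
    |(i : ℝ)| ≤ 400 / 189 * dist ((e (m, i, j, k) : Sites₀ t A) : EuclideanSpace ℝ (Fin 3)) (e (m, 0, 0, 0)) ∧
    |(j : ℝ)| ≤ 400 / 189 * dist ((e (m, i, j, k) : Sites₀ t A) : EuclideanSpace ℝ (Fin 3)) (e (m, 0, 0, 0)) ∧
    |(k : ℝ)| ≤ 200 / 189 * dist ((e (m, i, j, k) : Sites₀ t A) : EuclideanSpace ℝ (Fin 3)) (e (m, 0, 0, 0)) := by
  have hd : dist ((e (m, i, j, k) : Sites₀ t A) : EuclideanSpace ℝ (Fin 3)) (e (m, 0, 0, 0)) =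
      ‖A ((i : ℝ) • triangularVec₁ 1 + (j : ℝ) • triangularVec₂ 1 + (k : ℝ) • layerNormal (2 * Real.sqrt (2 / 3)))‖ := by
    rw [he, he, dist_eq_norm]
    simp
  rw [hd]
  exact abs_coord_le_norm_apply_latticeVec hA i j k

end

end Summit.AtomisticToContinuum.Crystallization.Theorems.ExcessDecayLiouville

end
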